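import Literature.Barriers.ValiantsHypothesis.CKRST20NaturalProofsExist
import Literature.Computability.AlgebraicComplexity.HittingSetsExist
import HarnessLib

/-!
# CKRST20 — the named fact `CKRST2020_lemma12` (hitting sets for size-`s` polynomials, [HS80]) DISCHARGED

Companion of `CKRST20NaturalProofsExist.lean` (cell `val-lit`, typer t20). Its named fact
`CKRST2020_lemma12` is Chatterjee–Kumar–Ramya–Saptharishi–Tengse 2020, v2 ‹Lemma 12›
(= Heintz–Schnorr 1980, Thm. 4.4 as used there): for `1 ≤ n ≤ s`, `1 ≤ d ≤ s`, `s ≥ 2` there is a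
hitting set `ℋ ⊂ [(sd)²]ⁿ` of size `≤ s^e` for the `n`-variate polynomials of degree `≤ d` and
circuit size `≤ s` over `ℂ`. It is PROVED here (`CKRST2020_lemma12_holds`, `e = 100`) from the tree's
field-independent existence theorem
`Literature.Computability.AlgebraicComplexity.HittingSets.exists_hittingSet` (universal circuit +
Rónyai–Babai–Ganapathy zero-pattern counting + Schwartz–Zippel; `HittingSetsExist.lean`) applied to
the grid side `S = {1, …, (sd)²} ⊂ ℂ` (`|S| = s²d² ≥ 2d + 1`), the points being read back in `ℤⁿ`.

Honest framing: a printed lemma (non-explicit hitting sets) discharged; nothing here bears on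
FSV Question 6 or VP ≠ VNP.

## References

* [ChatterjeeKumarRamyaSaptharishiTengse2020] v2 ‹Lemma 12› (§4) = arXiv v4 Lemma 3.6;
  locator: paper:arxiv-2004.14147 p0011.txt:L7.
* [HeintzSchnorr1980] Thm. 4.4.
-/

noncomputable section

namespace Literature.Barriers.ValiantsHypothesis

open Literature.Computability.AlgebraicComplexity MvPolynomial

namespace CKRST2020

/-! ### Arithmetic: the size bound is `≤ s¹⁰⁰` in the lemma's regime -/

/-- `log₂((s²d²)ⁿ(3d+1) + 1) + 1 ≤ 7 s²` for `1 ≤ d ≤ s`, `n ≤ s`, `s ≥ 2`. [folklore] -/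
private theorem log_bound {n d s : ℕ} (hns : n ≤ s) (hd : 1 ≤ d) (hds : d ≤ s) (hs : 2 ≤ s) :
    Nat.log 2 (((s * d) ^ 2) ^ n * (3 * d + 1) + 1) + 1 ≤ 7 * s ^ 2 := by
  have h1s : 1 ≤ s := by omega
  have hsd : (s * d) ^ 2 ≤ s ^ 4 := by
    calc (s * d) ^ 2 ≤ (s * s) ^ 2 := Nat.pow_le_pow_left (Nat.mul_le_mul_left s hds) 2
      _ = s ^ 4 := by ring
  have hBn : ((s * d) ^ 2) ^ n ≤ s ^ (4 * s) := by
    calc ((s * d) ^ 2) ^ n ≤ (s ^ 4) ^ n := Nat.pow_le_pow_left hsd n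
      _ = s ^ (4 * n) := by rw [← pow_mul]
      _ ≤ s ^ (4 * s) := Nat.pow_le_pow_right h1s (by omega)
  have h2s : s ≤ 2 ^ s := (Nat.lt_two_pow_self).le
  have hpow : s ^ (4 * s) ≤ 2 ^ (4 * s ^ 2) := by
    calc s ^ (4 * s) ≤ (2 ^ s) ^ (4 * s) := Nat.pow_le_pow_left h2s _
      _ = 2 ^ (4 * s ^ 2) := by rw [← pow_mul]; ring_nf
  have h3d : 3 * d + 1 ≤ 2 ^ (s + 2) := by
    have : 3 * d + 1 ≤ 4 * s := by omega
    calc 3 * d + 1 ≤ 4 * s := this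
      _ ≤ 4 * 2 ^ s := Nat.mul_le_mul_left 4 h2s
      _ = 2 ^ (s + 2) := by rw [pow_add]; ring
  have hX : ((s * d) ^ 2) ^ n * (3 * d + 1) + 1 < 2 ^ (4 * s ^ 2 + (s + 2) + 1) := by
    have hk : 1 ≤ 2 ^ (4 * s ^ 2 + (s + 2)) := Nat.one_le_two_pow
    calc ((s * d) ^ 2) ^ n * (3 * d + 1) + 1 ≤ 2 ^ (4 * s ^ 2) * 2 ^ (s + 2) + 1 :=
          Nat.add_le_add_right (Nat.mul_le_mul (hBn.trans hpow) h3d) 1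
      _ = 2 ^ (4 * s ^ 2 + (s + 2)) + 1 := by rw [← pow_add]
      _ < 2 ^ (4 * s ^ 2 + (s + 2) + 1) := by
          have h2 : 1 < 2 ^ (4 * s ^ 2 + (s + 2)) := Nat.one_lt_two_pow (by positivity)
          rw [pow_succ 2 (4 * s ^ 2 + (s + 2)), mul_two]
          exact Nat.add_lt_add_left h2 _
  have hlog : Nat.log 2 (((s * d) ^ 2) ^ n * (3 * d + 1) + 1) < 4 * s ^ 2 + (s + 2) + 1 :=
    Nat.log_lt_of_lt_pow (by omega) hX
  have hs2 : s + 3 ≤ 3 * s ^ 2 := by nlinarith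
  omega

/-- The size bound of `HittingSets.exists_hittingSet` is `≤ s¹⁰⁰` in the lemma's regime. [folklore] -/
private theorem size_bound {n d s : ℕ} (hns : n ≤ s) (hd : 1 ≤ d) (hds : d ≤ s) (hs : 2 ≤ s) :
    9376 * (n + d + s + 2) ^ 26 * (Nat.log 2 (((s * d) ^ 2) ^ n * (3 * d + 1) + 1) + 1) + 1 ≤
      s ^ 100 := by
  have h1s : 1 ≤ s := by omega
  have hs2 : 4 ≤ s ^ 2 := by nlinarith
  have hs3 : 8 ≤ s ^ 3 := by nlinarith
  -- every constant is a power of `s ≥ 2`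
  have hK : 9376 ≤ s ^ 14 := by
    calc 9376 ≤ 2 ^ 14 := by norm_num
      _ ≤ s ^ 14 := Nat.pow_le_pow_left hs 14
  have hT : n + d + s + 2 ≤ s ^ 2 * s := by
    calc n + d + s + 2 ≤ 4 * s := by omega
      _ ≤ s ^ 2 * s := Nat.mul_le_mul_right s hs2
  have h26 : (n + d + s + 2) ^ 26 ≤ s ^ 78 := by
    calc (n + d + s + 2) ^ 26 ≤ (s ^ 2 * s) ^ 26 := Nat.pow_le_pow_left hT 26
      _ = s ^ 78 := by rw [← pow_succ, ← pow_mul]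
  have hL : Nat.log 2 (((s * d) ^ 2) ^ n * (3 * d + 1) + 1) + 1 ≤ s ^ 5 := by
    refine (log_bound hns hd hds hs).trans ?_
    calc 7 * s ^ 2 ≤ s ^ 3 * s ^ 2 := Nat.mul_le_mul_right _ (by omega)
      _ = s ^ 5 := by rw [← pow_add]
  have h97 : s ^ 97 + 1 ≤ s ^ 100 := by
    have h1 : 1 ≤ s ^ 97 := Nat.one_le_pow _ _ h1s
    calc s ^ 97 + 1 ≤ 2 * s ^ 97 := by omega
      _ ≤ s ^ 3 * s ^ 97 := Nat.mul_le_mul_right _ (by omega)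
      _ = s ^ 100 := by rw [← pow_add]
  calc 9376 * (n + d + s + 2) ^ 26 * (Nat.log 2 (((s * d) ^ 2) ^ n * (3 * d + 1) + 1) + 1) + 1
      ≤ s ^ 14 * s ^ 78 * s ^ 5 + 1 := by gcongr
    _ = s ^ 97 + 1 := by rw [← pow_add, ← pow_add]
    _ ≤ s ^ 100 := h97

end CKRST2020

/-- **CKRST 2020 v2 ‹Lemma 12› ([HS80] hitting sets) — DISCHARGED** (`e = 100`): for
`1 ≤ n ≤ s`, `1 ≤ d ≤ s`, `s ≥ 2` there is `ℋ ⊂ [(sd)²]ⁿ ⊂ ℤⁿ`, `|ℋ| ≤ s¹⁰⁰`, hitting every nonzero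
member of `vpSlice ℂ n d s`. From `HittingSets.exists_hittingSet` on the side `S = {1,…,(sd)²} ⊂ ℂ`.
[cite: ChatterjeeKumarRamyaSaptharishiTengse2020, v2 ‹Lemma 12› (§4) = Lemma 3.6 (arXiv v4)]
locator: paper:arxiv-2004.14147 p0011.txt:L7 -/
theorem CKRST2020_lemma12_holds : CKRST2020_lemma12 := by
  classical
  refine ⟨100, fun n d s hn hns hd hds hs => ?_⟩
  -- the grid side `S = {1, …, (sd)²} ⊂ ℂ`
  let S : Finset ℂ := (Finset.Icc 1 ((s * d) ^ 2)).image (fun k : ℕ => (k : ℂ))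
  have hScard : S.card = (s * d) ^ 2 := by
    simp only [S]
    rw [Finset.card_image_of_injective _ Nat.cast_injective]
    simp
  have hS : 2 * d + 1 ≤ S.card := by
    rw [hScard]
    have h2 : 2 ≤ s * d := le_trans hs (Nat.le_mul_of_pos_right s hd)
    nlinarith
  obtain ⟨H, hHS, hHcard, hhit⟩ := HittingSets.exists_hittingSet (F := ℂ) n s d S hS
  -- reading grid points back in `ℤ`
  let back : ℂ → ℤ := fun z => if h : ∃ k : ℕ, (k : ℂ) = z then (h.choose : ℤ) else 0
  have hback : ∀ k : ℕ, back (k : ℂ) = k := by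
    intro k
    have h : ∃ k' : ℕ, (k' : ℂ) = (k : ℂ) := ⟨k, rfl⟩
    have hb : back (k : ℂ) = (h.choose : ℤ) := by simp only [back]; rw [dif_pos h]
    rw [hb]
    have := h.choose_spec
    exact_mod_cast this
  have hmemS : ∀ z ∈ S, ∃ k : ℕ, (1 ≤ k ∧ k ≤ (s * d) ^ 2) ∧ (k : ℂ) = z := by
    intro z hz
    obtain ⟨k, hk, rfl⟩ := Finset.mem_image.mp hz
    exact ⟨k, Finset.mem_Icc.mp hk, rfl⟩
  refine ⟨H.image (fun a i => back (a i)), ?_, ?_, ?_⟩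
  · -- coordinates in `[(sd)²]`
    intro x hx i
    obtain ⟨a, ha, rfl⟩ := Finset.mem_image.mp hx
    obtain ⟨k, ⟨hk1, hk2⟩, hk⟩ := hmemS (a i) (hHS a ha i)
    show 1 ≤ back (a i) ∧ back (a i) ≤ (((s * d) ^ 2 : ℕ) : ℤ)
    rw [← hk, hback]
    exact ⟨by exact_mod_cast hk1, by exact_mod_cast hk2⟩
  · -- size
    refine Finset.card_image_le.trans (hHcard.trans ?_)
    rw [hScard]
    exact CKRST2020.size_bound hns hd hds hs
  · -- hitting
    intro f hf hf0
    obtain ⟨a, ha, hne⟩ := hhit f hf.1 hf.2 hf0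
    refine ⟨fun i => back (a i), Finset.mem_image.mpr ⟨a, ha, rfl⟩, ?_⟩
    have hfun : (fun i => ((back (a i) : ℤ) : ℂ)) = a := by
      funext i
      obtain ⟨k, -, hk⟩ := hmemS (a i) (hHS a ha i)
      rw [← hk, hback]
      push_cast
      rfl
    rw [hfun]
    exact hne

end Literature.Barriers.ValiantsHypothesis

end
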